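import Literature.IUT.LogVolume.TensorPacketConductor
import Literature.IUT.LogVolume.GenuineLogThetaPerImageSubIndeterminacy
import HarnessLib

/-!
# Factorwise NORM-NON-INCREASING sub-indeterminacies (e.g. factorwise isometries): the per-image orbit of a Θ-region stays inside
# `p^{−N}·(the region)` with `p^N` in the conductor of `R_I` — gain `≤ N·log p`, NO content / log-shell term
# ([IUTchIV] Prop. 1.1; Dupuy–Hilado §4.9, §4.12; [IUTchII] Ex. 1.8 (iv) "G-isometries")

Proof-only file of the abc-iut cell (WAVE-3 discharge seat abc-iut-c312-d1, gen 10; sequel to `TensorPacketOrbitStable` (p500042) and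
`GenuineLogThetaPerImageSubIndeterminacy` (p503117), row «C:PERIMAGE-IND2-SEMILINEAR» part 5). TAKES NO SIDE on [IUTchIII] Cor. 3.12.

Between the two ends typed so far — STABILISERS of the Θ-region `M = ι_j(t)·(R_I)^∼` (zero gain) and the full CONTAINER
`Aut_{ℚ_p}(V : log_p(R_I^×))` (gain = different term + content/log-shell term, `packetHull_orbit_eq_zpow`; the same for the FACTORWISE
product of single-factor containers, `TensorPacketFactorwiseOrbitSpan`) — sits the natural reading of [IUTchII] Ex. 1.8 (iv)'s word
"`G`-ISOMETRIES" as factorwise NORM-isometries of the factors `k_i` (the R-J lane's row Y-29b "𝒪-stable ℚ_p-linear isometries"; such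
maps are in general NOT stabilisers of `(R_I)^∼` — the E-lane's MOVERS `WildCubicIsometryMover` / `WildQuadraticIsometryMover`). THIS
FILE bounds their per-image gain by the CONDUCTOR of `R_I` in `(R_I)^∼` alone:

* `congr_image_iota_smul_integerPacket_subset` — for factorwise `ℚ_p`-linear maps `g_i` of operator norm `≤ 1` (contractions; isometries
  in particular), `⊗g_i` maps `ι_j(t)·R_I` INTO `ι_j(t)·R_I` (`(⊗g_i)(x_0 ⊗ ⋯ ⊗ t·x_j) = g_0x_0 ⊗ ⋯ ⊗ g_j(t·x_j)` and `‖g_j(t·x_j)‖ ≤ ‖t‖`,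
  so `g_j(t·x_j) ∈ t·R_j`; abc-iut-S1's `integerPacket_induction`);
* **`congr_image_iota_smul_normalizedPacket_subset`** — hence, for any `N ∈ ℤ` with `p^N·(R_I)^∼ ⊆ R_I` (an element of the
  CONDUCTOR; `ppow_smul_normalizedPacket_subset_integerPacket_of_le`: every `N ≥ d_I − d_{L_J}` for all factors `L_J` works, abc-iut-c312-5's
  `smul_normalizedPacket_subset_integerPacket_of_norm_dEquiv_le` = [IUTchIV] Prop. 1.1 as an equivalence):
  `(⊗g_i)(ι_j(t)·(R_I)^∼) ⊆ p^{−N}·ι_j(t)·(R_I)^∼`;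
* **`packetHull_iUnion_image_subset_of_factorwise_norm_le`**, **`packetLogμ_packetHull_iUnion_image_le_of_factorwise_norm_le`** — for ANY
  family `H` of such factorwise contractions: `hull(⋃_{g∈H} g(M)) ⊆ p^{−N}·M` and `log μ̄(hull(⋃ g(M))) ≤ N·log p + log μ̄(M)`: the gain is
  AT MOST the conductor exponent — NO content (`−m·log p`) / log-shell term, in contrast with the container;
* the real packet (any shell): **`realPrimePacketWith_logμ_hull_orbitH_le_of_factorwise_norm_le`** per summand, and summed with
  Dupuy–Hilado's weights **`realPrimePacketWith_lnνLp_hull_orbitH_le_of_factorwise_norm_le`**: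
  reading (P) over a factorwise-contraction sub-indeterminacy `≤` bare value `+ (1/ℓ⋆)·Σ_i Σ_{v⃗} N(i,v⃗)·log p·Π Pr(v_b)`.

HONEST WORDS: statements about OUR hull functional and OUR regions; whether print's `Ism` acts on the log-shells by norm-isometries (or by
anything norm-non-increasing) is READING MATTER ([IUTchII] Ex. 1.8 (iv) defines `Ism` by lattice preservation at every open `H ⊆ G`, not by a
norm; ref-b F-B28-1; C-lit (L1)–(L8)); nothing here decides it; no side taken; no abc claim. [cite: Mochizuki2012, IUTchIV Prop. 1.1 p. 9,
Prop. 1.2 p. 10; IUTchII Ex. 1.8 (iv) p. 39; IUTchIII Cor. 3.12 proof Step (x) p. 181] [cite: DupuyHilado2025, §3.9, §4.9, §4.12]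
[cite: SerreLocalFields1979, Ch. III §6] [claim: Mochizuki2012, status: disputed] for every IUT quotation. PROOF-ONLY: no definitions,
no new `Prop`.
-/

noncomputable section

open Set Module Function
open scoped Pointwise TensorProduct

namespace Literature.IUT.LogVolume

section Packet

variable (p : ℕ) [Fact p.Prime]
variable {I : Type} [Fintype I] [DecidableEq I]
variable (k : I → Type) [∀ i, NontriviallyNormedField (k i)] [∀ i, NormedAlgebra ℚ_[p] (k i)]

/-! ## 1. Factorwise contractions map `ι_j(t)·R_I` into itself -/

omit [Fintype I] in
/-- **`(⊗g_i)(ι_j(t)·R_I) ⊆ ι_j(t)·R_I` for factorwise maps of operator norm `≤ 1`**: on a generator `x_0 ⊗ ⋯ ⊗ t·x_j` (`‖x_i‖ ≤ 1`) the image is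
`g_0x_0 ⊗ ⋯ ⊗ g_j(t·x_j)` with `‖g_ix_i‖ ≤ 1` and `g_j(t·x_j) = t·x_j'`, `‖x_j'‖ ≤ 1`. [cite: Mochizuki2012, IUTchIV Prop. 1.1 p. 9] -/
theorem congr_image_iota_smul_integerPacket_subset (g : ∀ i, k i ≃ₗ[ℚ_[p]] k i) (hg : ∀ i x, ‖g i x‖ ≤ ‖x‖)
    (j : I) (t : k j) :
    (PiTensorProduct.congr g : PacketAlgebra p k ≃ₗ[ℚ_[p]] PacketAlgebra p k) ''
        (iota p k j t • (integerPacket p k : Set (PacketAlgebra p k))) ⊆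
      iota p k j t • (integerPacket p k : Set (PacketAlgebra p k)) := by
  classical
  rintro _ ⟨_, ⟨r, hr, rfl⟩, rfl⟩
  change r ∈ integerPacket p k at hr
  show (PiTensorProduct.congr g : PacketAlgebra p k ≃ₗ[ℚ_[p]] PacketAlgebra p k) (iota p k j t • r) ∈
    iota p k j t • (integerPacket p k : Set (PacketAlgebra p k))
  refine integerPacket_induction p k
    (C := fun r => (PiTensorProduct.congr g : PacketAlgebra p k ≃ₗ[ℚ_[p]] PacketAlgebra p k) (iota p k j t • r) ∈
      iota p k j t • (integerPacket p k : Set (PacketAlgebra p k))) ?_ ?_ ?_ ?_ hr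
  · intro x hx
    -- `ι_j(t)·⊗x_i = ⊗(mulSingle j t · x)` and `(⊗g_i)(⊗z_i) = ⊗ g_i z_i`
    have hprod : iota p k j t • purePacket p k x = purePacket p k (Pi.mulSingle j t * x) := by
      rw [smul_eq_mul, iota_eq_purePacket, purePacket_mul]
    have hcongr : (PiTensorProduct.congr g : PacketAlgebra p k ≃ₗ[ℚ_[p]] PacketAlgebra p k)
        (purePacket p k (Pi.mulSingle j t * x)) = purePacket p k (fun i => g i ((Pi.mulSingle j t * x) i)) :=
      PiTensorProduct.congr_tprod g _
    rw [hprod, hcongr]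
    refine Set.mem_smul_set.mpr ?_
    by_cases ht : t = 0
    · -- the `j`-th slot is `g_j 0 = 0`, so the pure tensor vanishes
      have h0 : (fun i => g i ((Pi.mulSingle j t * x) i)) j = 0 := by
        simp [ht]
      have hz : purePacket p k (fun i => g i ((Pi.mulSingle j t * x) i)) = 0 :=
        (PiTensorProduct.tprod ℚ_[p]).map_coord_zero j h0
      exact ⟨0, (integerPacket p k).zero_mem, by rw [hz, smul_zero]⟩
    · -- divide the `j`-th slot by `t`
      set x' : Π i, k i := Function.update (fun i => g i (x i)) j (t⁻¹ * g j (t * x j)) with hx'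
      have hx'le : ∀ i, ‖x' i‖ ≤ 1 := by
        intro i
        by_cases h : i = j
        · subst h
          rw [hx', Function.update_self, norm_mul, norm_inv]
          have h1 : ‖g i (t * x i)‖ ≤ ‖t‖ * ‖x i‖ := (hg i _).trans (norm_mul_le _ _)
          have htpos : 0 < ‖t‖ := norm_pos_iff.mpr ht
          calc ‖t‖⁻¹ * ‖g i (t * x i)‖ ≤ ‖t‖⁻¹ * (‖t‖ * ‖x i‖) := mul_le_mul_of_nonneg_left h1 (by positivity)
            _ = ‖x i‖ := by field_simp
            _ ≤ 1 := hx i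
        · rw [hx', Function.update_of_ne h]
          exact (hg i _).trans (hx i)
      have heq : (fun i => g i ((Pi.mulSingle j t * x) i)) = Pi.mulSingle j t * x' := by
        funext i
        by_cases h : i = j
        · subst h
          simp only [Pi.mul_apply, hx', Function.update_self, Pi.mulSingle_eq_same]
          rw [← mul_assoc, mul_inv_cancel₀ ht, one_mul]
        · simp only [Pi.mul_apply, hx', Function.update_of_ne h, Pi.mulSingle_eq_of_ne h, one_mul]
      refine ⟨purePacket p k x', purePacket_mem_integerPacket p k hx'le, ?_⟩
      rw [heq, smul_eq_mul, iota_eq_purePacket, purePacket_mul]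
  · rw [smul_zero, map_zero]
    exact Set.mem_smul_set.mpr ⟨0, (integerPacket p k).zero_mem, smul_zero _⟩
  · intro a b ha hb
    obtain ⟨a', ha', ha⟩ := Set.mem_smul_set.mp ha
    obtain ⟨b', hb', hb⟩ := Set.mem_smul_set.mp hb
    refine Set.mem_smul_set.mpr ⟨a' + b', (integerPacket p k).add_mem ha' hb', ?_⟩
    rw [smul_add, ha, hb, smul_add, map_add]
  · intro a ha
    obtain ⟨a', ha', ha⟩ := Set.mem_smul_set.mp ha
    refine Set.mem_smul_set.mpr ⟨-a', (integerPacket p k).neg_mem ha', ?_⟩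
    rw [smul_neg, ha, smul_neg, map_neg]

/-! ## 2. With the conductor: the orbit of `ι_j(t)·(R_I)^∼` stays in `p^{−N}·ι_j(t)·(R_I)^∼` -/

omit [Fintype I] [DecidableEq I] in
/-- `p^{−N}·(p^N·y) = y` in `V`. [folklore] -/
private theorem ppow_neg_smul_ppow_mul (N : ℤ) (y : PacketAlgebra p k) :
    ((p : ℚ_[p]) ^ (-N)) • (ppow p k N * y) = y := by
  rw [Algebra.smul_def, ← mul_assoc]
  change ppow p k (-N) * ppow p k N * y = y
  rw [ppow_neg_mul_self, one_mul]

omit [Fintype I] in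
/-- **`(⊗g_i)(ι_j(t)·(R_I)^∼) ⊆ p^{−N}·(ι_j(t)·(R_I)^∼)`** for factorwise contractions `g_i` and any `N` with `p^N·(R_I)^∼ ⊆ R_I`
(an element of the conductor of `R_I`): `y ∈ (R_I)^∼ ⇒ p^N·y ∈ R_I`, `(⊗g_i)` is `ℚ_p`-linear, and §1.
[cite: Mochizuki2012, IUTchIV Prop. 1.1 p. 9] [cite: DupuyHilado2025, §4.9] -/
theorem congr_image_iota_smul_normalizedPacket_subset (g : ∀ i, k i ≃ₗ[ℚ_[p]] k i) (hg : ∀ i x, ‖g i x‖ ≤ ‖x‖)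
    (j : I) (t : k j) {N : ℤ}
    (hN : ppow p k N • (normalizedPacket p k : Set (PacketAlgebra p k)) ⊆ (integerPacket p k : Set (PacketAlgebra p k))) :
    (PiTensorProduct.congr g : PacketAlgebra p k ≃ₗ[ℚ_[p]] PacketAlgebra p k) ''
        (iota p k j t • (normalizedPacket p k : Set (PacketAlgebra p k))) ⊆
      ((p : ℚ_[p]) ^ (-N)) • (iota p k j t • (normalizedPacket p k : Set (PacketAlgebra p k))) := by
  rintro _ ⟨_, ⟨y, hy, rfl⟩, rfl⟩
  have hNy : ppow p k N * y ∈ integerPacket p k := hN (Set.smul_mem_smul_set hy)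
  have hmem := congr_image_iota_smul_integerPacket_subset p k g hg j t
    ⟨iota p k j t • (ppow p k N * y), Set.smul_mem_smul_set hNy, rfl⟩
  obtain ⟨r, hr, hr'⟩ := hmem
  -- `G(ι t · y) = p^{−N} • G(ι t · p^N y)`
  have hlin : (PiTensorProduct.congr g : PacketAlgebra p k ≃ₗ[ℚ_[p]] PacketAlgebra p k) (iota p k j t • y) =
      ((p : ℚ_[p]) ^ (-N)) • (PiTensorProduct.congr g : PacketAlgebra p k ≃ₗ[ℚ_[p]] PacketAlgebra p k)
        (iota p k j t • (ppow p k N * y)) := by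
    rw [← LinearEquiv.map_smul]
    congr 1
    rw [smul_eq_mul, smul_eq_mul, ← mul_smul_comm, ppow_neg_smul_ppow_mul]
  refine ⟨(PiTensorProduct.congr g : PacketAlgebra p k ≃ₗ[ℚ_[p]] PacketAlgebra p k) (iota p k j t • (ppow p k N * y)), ?_,
    hlin.symm⟩
  rw [← hr']
  exact Set.smul_mem_smul_set (integerPacket_le_normalizedPacket p k hr)

variable [∀ i, IsUltrametricDist (k i)] [∀ i, ProperSpace (k i)]

/-- **Which `N` work**: every integer `N ≥ d_I − d_{L_J}` for all factors `L_J` of `V ≅ ∏ L_J` puts `p^N` in the conductor: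
`p^N·(R_I)^∼ ⊆ R_I` (abc-iut-c312-5's conductor criterion, [IUTchIV] Prop. 1.1 as an equivalence; `‖ψ_J(p^N)‖ = p^{−N}`).
[cite: Mochizuki2012, IUTchIV Prop. 1.1 p. 9] -/
theorem ppow_smul_normalizedPacket_subset_integerPacket_of_le [Nonempty I] {N : ℤ}
    (hN : ∀ J, dSum p k - differentOrd p (DFac p k J) ≤ N) :
    ppow p k N • (normalizedPacket p k : Set (PacketAlgebra p k)) ⊆ (integerPacket p k : Set (PacketAlgebra p k)) := by
  refine smul_normalizedPacket_subset_integerPacket_of_norm_dEquiv_le p k fun J => ?_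
  rw [norm_psi_ppow_apply]
  have hp1 : (1 : ℝ) < p := by exact_mod_cast (Fact.out : p.Prime).one_lt
  have h1 : ((p : ℝ) ^ (-N : ℤ)) = (p : ℝ) ^ ((-N : ℤ) : ℝ) := (Real.rpow_intCast _ _).symm
  rw [h1]
  refine Real.rpow_le_rpow_of_exponent_le hp1.le ?_
  push_cast
  linarith [hN J]

/-! ## 3. Hull and log-volume: the gain is at most the conductor exponent -/

omit [Fintype I] [∀ i, IsUltrametricDist (k i)] [∀ i, ProperSpace (k i)] in
/-- **`hull(⋃_{g∈H} g(ι_j(t)·(R_I)^∼)) ⊆ p^{−N}·ι_j(t)·(R_I)^∼`** for any family `H` of factorwise contractions (`p^N` in the conductor):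
the translate `p^{−N}·ι_j(t)·(R_I)^∼` is hull-closed. [cite: DupuyHilado2025, §4.9, §4.12] [cite: Mochizuki2012, IUTchIV Prop. 1.1 p. 9] -/
theorem packetHull_iUnion_image_subset_of_factorwise_norm_le
    (H : Subgroup (PacketAlgebra p k ≃ₗ[ℚ_[p]] PacketAlgebra p k))
    (hH : ∀ G ∈ H, ∃ g : ∀ i, k i ≃ₗ[ℚ_[p]] k i, (∀ i x, ‖g i x‖ ≤ ‖x‖) ∧
      (G : PacketAlgebra p k ≃ₗ[ℚ_[p]] PacketAlgebra p k) = PiTensorProduct.congr g)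
    (j : I) (t : k j) {N : ℤ}
    (hN : ppow p k N • (normalizedPacket p k : Set (PacketAlgebra p k)) ⊆ (integerPacket p k : Set (PacketAlgebra p k))) :
    packetHull p k (⋃ G : H, (G : PacketAlgebra p k ≃ₗ[ℚ_[p]] PacketAlgebra p k) ''
        (iota p k j t • (normalizedPacket p k : Set (PacketAlgebra p k)))) ⊆
      ((p : ℚ_[p]) ^ (-N)) • (iota p k j t • (normalizedPacket p k : Set (PacketAlgebra p k))) := by
  have hclosed : packetHull p k (((p : ℚ_[p]) ^ (-N)) • (iota p k j t • (normalizedPacket p k : Set (PacketAlgebra p k)))) =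
      ((p : ℚ_[p]) ^ (-N)) • (iota p k j t • (normalizedPacket p k : Set (PacketAlgebra p k))) := by
    rw [← ppow_smul_set_eq, smul_smul]
    exact packetHull_smul_normalizedPacket p k _
  rw [← hclosed]
  refine packetHull_mono p k (Set.iUnion_subset fun G => ?_)
  obtain ⟨g, hg, hG⟩ := hH G G.2
  rw [hG]
  exact congr_image_iota_smul_normalizedPacket_subset p k g hg j t hN

/-- **THE GAIN BOUND**: `log μ̄(hull(⋃_{g∈H} g(ι_j(t)·(R_I)^∼))) ≤ N·log p + log μ̄(ι_j(t)·(R_I)^∼)` for any family `H` of factorwise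
contractions and any `p^N` in the conductor (`t ≠ 0`) — only the conductor exponent, NO content/log-shell term (contrast: over the container
the hull is `hull(p^m·log_p(R_I^×))`). [cite: DupuyHilado2025, §4.9, §4.12] [cite: Mochizuki2012, IUTchIV Prop. 1.1 p. 9]
[claim: Mochizuki2012, status: disputed] -/
theorem packetLogμ_packetHull_iUnion_image_le_of_factorwise_norm_le [Nonempty I]
    (H : Subgroup (PacketAlgebra p k ≃ₗ[ℚ_[p]] PacketAlgebra p k))
    (hH : ∀ G ∈ H, ∃ g : ∀ i, k i ≃ₗ[ℚ_[p]] k i, (∀ i x, ‖g i x‖ ≤ ‖x‖) ∧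
      (G : PacketAlgebra p k ≃ₗ[ℚ_[p]] PacketAlgebra p k) = PiTensorProduct.congr g)
    (j : I) {t : k j} (ht : t ≠ 0) {N : ℤ}
    (hN : ppow p k N • (normalizedPacket p k : Set (PacketAlgebra p k)) ⊆ (integerPacket p k : Set (PacketAlgebra p k))) :
    packetLogμ p k (packetHull p k (⋃ G : H, (G : PacketAlgebra p k ≃ₗ[ℚ_[p]] PacketAlgebra p k) ''
        (iota p k j t • (normalizedPacket p k : Set (PacketAlgebra p k))))) ≤
      N * Real.log p + packetLogμ p k (iota p k j t • (normalizedPacket p k : Set (PacketAlgebra p k))) := by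
  have hM : PacketAdm p k (iota p k j t • (normalizedPacket p k : Set (PacketAlgebra p k))) :=
    packetAdm_iota_smul p k j ht (packetAdm_normalizedPacket p k)
  have hbig : PacketAdm p k (((p : ℚ_[p]) ^ (-N)) • (iota p k j t • (normalizedPacket p k : Set (PacketAlgebra p k)))) :=
    packetAdm_const_smul p k (zpow_ne_zero _ (Nat.cast_ne_zero.mpr (Fact.out : p.Prime).ne_zero)) hM
  have hsub := packetHull_iUnion_image_subset_of_factorwise_norm_le p k H hH j t hN
  have hsup : iota p k j t • (normalizedPacket p k : Set (PacketAlgebra p k)) ⊆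
      packetHull p k (⋃ G : H, (G : PacketAlgebra p k ≃ₗ[ℚ_[p]] PacketAlgebra p k) ''
        (iota p k j t • (normalizedPacket p k : Set (PacketAlgebra p k)))) := by
    refine Set.Subset.trans ?_ (subset_packetHull p k _)
    intro x hx
    refine Set.mem_iUnion.mpr ⟨(1 : H), ?_⟩
    have h1 : (((1 : H) : PacketAlgebra p k ≃ₗ[ℚ_[p]] PacketAlgebra p k) : PacketAlgebra p k → PacketAlgebra p k) = id := by
      rw [OneMemClass.coe_one, LinearEquiv.coe_one]
    rw [h1]
    exact ⟨x, hx, rfl⟩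
  have hadm : PacketAdm p k (packetHull p k (⋃ G : H, (G : PacketAlgebra p k ≃ₗ[ℚ_[p]] PacketAlgebra p k) ''
      (iota p k j t • (normalizedPacket p k : Set (PacketAlgebra p k))))) :=
    packetAdm_of_subset_of_subset p k hM hbig hsup hsub
  calc packetLogμ p k _ ≤ packetLogμ p k (((p : ℚ_[p]) ^ (-N)) • (iota p k j t •
          (normalizedPacket p k : Set (PacketAlgebra p k)))) := packetLogμ_mono p k hadm hbig hsub
    _ = N * Real.log p + packetLogμ p k (iota p k j t • (normalizedPacket p k : Set (PacketAlgebra p k))) := by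
        rw [← ppow_smul_set_eq, packetLogμ_ppow_smul p k (-N) hM]
        push_cast
        ring

end Packet

/-! ## 4. The real packet: reading (P) over factorwise contractions ≤ bare + conductor term -/

section RealPacketWith

variable {F : Type} [Field F] [NumberField F]
variable (p : ℕ) [Fact p.Prime] (𝔽 : LocalFields F p)
variable (c : (j : ℕ) → (Fin (j + 1) → placesOver F p) → ℚ_[p]) (hc0 : ∀ j e, c j e ≠ 0)
  (hcσ : ∀ (j : ℕ) (σ : Equiv.Perm (Fin (j + 1))) (e : Fin (j + 1) → placesOver F p), c j (e ∘ σ) = c j e)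

/-- **Per summand**: for a subgroup `H_{v⃗}` of factorwise contractions and `p^{N}` in the conductor of the summand,
`log μ̄(hull of the H-orbit of O_𝕃(−P_Θ)_{v⃗}) ≤ N·log p + log μ̄(O_𝕃(−P_Θ)_{v⃗})`. [cite: DupuyHilado2025, §3.9, §4.12]
[cite: Mochizuki2012, IUTchIV Prop. 1.1 p. 9] [claim: Mochizuki2012, status: disputed] -/
theorem realPrimePacketWith_logμ_hull_orbitH_le_of_factorwise_norm_le {lstar : ℕ}
    (t : Fin lstar → (v : placesOver F p) → (𝔽.k v)ˣ) (i : Fin lstar) (e : Fin ((i : ℕ) + 1 + 1) → placesOver F p)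
    (H : Subgroup (PacketAlgebra p (fun b => 𝔽.k (e b)) ≃ₗ[ℚ_[p]] PacketAlgebra p (fun b => 𝔽.k (e b))))
    (hH : ∀ G ∈ H, ∃ g : ∀ b, 𝔽.k (e b) ≃ₗ[ℚ_[p]] 𝔽.k (e b), (∀ b x, ‖g b x‖ ≤ ‖x‖) ∧
      (G : PacketAlgebra p (fun b => 𝔽.k (e b)) ≃ₗ[ℚ_[p]] PacketAlgebra p (fun b => 𝔽.k (e b))) = PiTensorProduct.congr g)
    {N : ℤ} (hN : ppow p (fun b => 𝔽.k (e b)) N • (normalizedPacket p (fun b => 𝔽.k (e b)) :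
        Set (PacketAlgebra p (fun b => 𝔽.k (e b)))) ⊆ (integerPacket p (fun b => 𝔽.k (e b)) : Set _)) :
    packetLogμ p (fun b => 𝔽.k (e b))
        (packetHull p (fun b => 𝔽.k (e b))
          (⋃ G : H, (G : PacketAlgebra p (fun b => 𝔽.k (e b)) ≃ₗ[ℚ_[p]] PacketAlgebra p (fun b => 𝔽.k (e b))) ''
            (realPrimePacketWith p 𝔽 c hc0 hcσ).pilotRegion t ((i : ℕ) + 1) e)) ≤
      N * Real.log p + packetLogμ p (fun b => 𝔽.k (e b)) ((realPrimePacketWith p 𝔽 c hc0 hcσ).pilotRegion t ((i : ℕ) + 1) e) := by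
  rw [realPrimePacketWith_pilotRegion_succ_eq]
  exact packetLogμ_packetHull_iUnion_image_le_of_factorwise_norm_le p (fun b => 𝔽.k (e b)) H hH (Fin.last _)
    (t i (e (Fin.last _))).ne_zero hN

/-- **READING (P) OVER FACTORWISE CONTRACTIONS ≤ BARE + CONDUCTOR TERM**: for a family `H` of subgroups of factorwise contractions and
conductor exponents `N(i, v⃗)`: `ln ν̄_{𝕃_p}(hulls of the H-orbits) ≤ ln ν̄_{𝕃_p}(O_𝕃(−P_Θ)) + (1/ℓ⋆)·Σ_i Σ_{v⃗} N(i,v⃗)·log p·Π_b Pr(v_b)`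
— the per-image Θ-side over such a sub-indeterminacy exceeds the bare pilot volume by at most the weighted conductor exponents (NO
content/log-shell gain). [cite: DupuyHilado2025, Def. 3.6.3, §4.12] [cite: Mochizuki2012, IUTchIV Prop. 1.1 p. 9; IUTchIII Cor. 3.12 proof Step (x) p. 181]
[claim: Mochizuki2012, status: disputed] -/
theorem realPrimePacketWith_lnνLp_hull_orbitH_le_of_factorwise_norm_le {lstar : ℕ}
    (t : Fin lstar → (v : placesOver F p) → (𝔽.k v)ˣ)
    (H : (j : ℕ) → (e : Fin (j + 1) → placesOver F p) →
      Subgroup (PacketAlgebra p (fun b => 𝔽.k (e b)) ≃ₗ[ℚ_[p]] PacketAlgebra p (fun b => 𝔽.k (e b))))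
    (hH : ∀ j e, ∀ G ∈ H j e, ∃ g : ∀ b, 𝔽.k (e b) ≃ₗ[ℚ_[p]] 𝔽.k (e b), (∀ b x, ‖g b x‖ ≤ ‖x‖) ∧
      (G : PacketAlgebra p (fun b => 𝔽.k (e b)) ≃ₗ[ℚ_[p]] PacketAlgebra p (fun b => 𝔽.k (e b))) = PiTensorProduct.congr g)
    (N : (i : Fin lstar) → (Fin ((i : ℕ) + 1 + 1) → placesOver F p) → ℤ)
    (hN : ∀ (i : Fin lstar) (e : Fin ((i : ℕ) + 1 + 1) → placesOver F p),
      ppow p (fun b => 𝔽.k (e b)) (N i e) • (normalizedPacket p (fun b => 𝔽.k (e b)) :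
        Set (PacketAlgebra p (fun b => 𝔽.k (e b)))) ⊆ (integerPacket p (fun b => 𝔽.k (e b)) : Set _)) :
    (realPrimePacketWith p 𝔽 c hc0 hcσ).lnνLp lstar (fun j e =>
        packetHull p (fun b => 𝔽.k (e b))
          (⋃ G : H j e, (G : PacketAlgebra p (fun b => 𝔽.k (e b)) ≃ₗ[ℚ_[p]] PacketAlgebra p (fun b => 𝔽.k (e b))) ''
            (realPrimePacketWith p 𝔽 c hc0 hcσ).pilotRegion t j e)) ≤
      (realPrimePacketWith p 𝔽 c hc0 hcσ).lnνLp lstar ((realPrimePacketWith p 𝔽 c hc0 hcσ).pilotRegion t)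
        + (1 / (lstar : ℝ)) * ∑ i : Fin lstar, ∑ e : Fin ((i : ℕ) + 1 + 1) → placesOver F p,
            (N i e : ℝ) * Real.log p * ∏ b, weight F (e b).1 := by
  unfold PrimePacket.lnνLp PrimePacket.lnνTensorPower
  rw [← mul_add, ← Finset.sum_add_distrib]
  refine mul_le_mul_of_nonneg_left (Finset.sum_le_sum fun i _ => ?_) (by positivity)
  rw [← Finset.sum_add_distrib]
  refine Finset.sum_le_sum fun e _ => ?_
  have h := realPrimePacketWith_logμ_hull_orbitH_le_of_factorwise_norm_le p 𝔽 c hc0 hcσ t i e (H _ e) (hH _ e) (hN i e)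
  have hw : 0 ≤ ∏ b, weight F (e b).1 := Finset.prod_nonneg fun b _ => weight_nonneg F _
  show packetLogμ p (fun b => 𝔽.k (e b)) _ * _ ≤ packetLogμ p (fun b => 𝔽.k (e b)) _ * _ + _
  nlinarith

end RealPacketWith

end Literature.IUT.LogVolume

end
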